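import Summits.KontsevichZagierPeriods.Zeta5Search.Certificates.DualPFComplex
import HarnessLib

/-!
# ζ(5) search — certificates: the lattice-sum ("two heights") identity for the coefficients `W(b)`, `U(b)`
(cell `pub-zeta5`, certifier 2, generation 2)

HONEST FRAMING: systematic search; no irrationality claim unless certified.

OUR work (Summit side; generic layer of the DECAY side). For dual parameters `b` in the box
(`InBox b`, `Σ_j b_j ≤ 3b₀+1`) the `ζ(3)`- and `ζ(5)`-coefficients `W(b) = Σ_p c_{2,p}`, `U(b) = Σ_p c_{4,p}` of
the very-well-poised series `F̃₇(b)` are sums of partial-fraction coefficients of the summand `R_b` with MASSIVE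
internal cancellation (record ray: `|W| ≈ e^{−9.05 n}·max_p |c_{2,p}|`). The cancellation is captured exactly by
evaluating `R_b` along a horizontal lattice line `ℤ + iY` (`Y > 0`): since the poles of `R_b` are integers,
Mathlib's `EisensteinSeries.qExpansion_identity`
`Σ_{k∈ℤ} (z+k)^{−(j+1)} = ((−2πi)^{j+1}/j!) Σ_{m≥0} m^j e^{2πimz}` (`z ∈ ℍ`) gives

* `hasSum_Rc_line` — **`Σ_{k∈ℤ} R_b(k+iY) = i·(4π³·A₂(Y)·W(b) − (4/3)π⁵·A₄(Y)·U(b))`**,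
  `A_j(Y) = Σ_{m≥0} m^j e^{−2πmY}` (the odd orders `o = 1,3,5` drop by well-poisedness, the simple poles
  `o = 0` by `Σ_p c_{0,p} = 0` and a telescoping lemma);
* `norm_comb_le_of_hasSum` — hence `|4π³A₂(Y)W − (4/3)π⁵A₄(Y)U| ≤ B` for ANY termwise majorant
  `‖R_b(k+iY)‖ ≤ g k` with `Σ_k g k = B`.

Two heights `Y₁ ≠ Y₂` then solve for `W` and `U` (`Certificates/EisensteinSolve.lean`). Nothing here is
specific to a ray; the price of height `Y` is the factor `e^{4πY}` hidden in `A_j(Y) ≈ e^{−2πY}`.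
-/

noncomputable section

open Finset Complex Filter Topology
open scoped Real

namespace Summit.KontsevichZagierPeriods.Zeta5Search.DualPF

open Summit.KontsevichZagierPeriods.Zeta5Search.DualSeries
open Summit.KontsevichZagierPeriods.Zeta5Search.WedgeDictionary
open Literature.NumberTheory.Transcendental.BallRivoal (pfEval poch)
open Polynomial (X C)

/-! ### The Eisenstein sums at height `Y` -/

/-- `q(Y) = e^{2πi·(iY)} = e^{−2πY}` as a complex number. -/
def qY (Y : ℝ) : ℂ := cexp (2 * π * I * ((Y : ℂ) * I))

/-- `A_j(Y) = Σ_{m ≥ 0} m^j q(Y)^m` (complex-valued; real and positive in fact). -/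
def Aq (j : ℕ) (Y : ℝ) : ℂ := ∑' m : ℕ, (m : ℂ) ^ j * qY Y ^ m

/-- `q(Y)` is the real number `e^{−2πY}`. -/
theorem qY_eq (Y : ℝ) : qY Y = ((Real.exp (-(2 * π * Y)) : ℝ) : ℂ) := by
  unfold qY
  rw [ofReal_exp]
  congr 1
  push_cast
  ring_nf
  rw [I_sq]
  ring

/-- The height `Y > 0` as a point `iY` of the upper half plane. -/
def hY (Y : ℝ) (h : 0 < Y) : UpperHalfPlane := ⟨(Y : ℂ) * I, by simpa using h⟩

/-- **Eisenstein's identity on the line `ℤ + iY`, shifted by an integer `m`**: for `j ≥ 1`,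
`Σ_{k∈ℤ} 1/(k + m + iY)^{j+1} = ((−2πi)^{j+1}/j!)·A_j(Y)`. -/
theorem hasSum_inv_pow_line {Y : ℝ} (h : 0 < Y) {j : ℕ} (hj : 1 ≤ j) (m : ℤ) :
    HasSum (fun k : ℤ => 1 / ((k : ℂ) + m + Y * I) ^ (j + 1))
      ((-2 * π * I) ^ (j + 1) / (j.factorial : ℂ) * Aq j Y) := by
  have hid := EisensteinSeries.qExpansion_identity hj (hY Y h)
  have hcoe : ((hY Y h : UpperHalfPlane) : ℂ) = (Y : ℂ) * I := rfl
  rw [hcoe] at hid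
  -- summability of the unshifted sum
  have hs : Summable fun n : ℤ => 1 / ((Y : ℂ) * I + n) ^ (j + 1) := by
    have h2 := EisensteinSeries.linear_right_summable ((Y : ℂ) * I) 1 (k := (j + 1 : ℕ)) (by omega)
    refine h2.congr fun n => ?_
    rw [one_div, Int.cast_one, one_mul, zpow_natCast]
  have hsum : HasSum (fun n : ℤ => 1 / ((Y : ℂ) * I + n) ^ (j + 1))
      ((-2 * π * I) ^ (j + 1) / (j.factorial : ℂ) * Aq j Y) := by
    rw [Aq, qY, ← hid]
    exact hs.hasSum
  -- shift by `m`
  have hshift := (Equiv.addRight m).hasSum_iff.2 hsum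
  refine hshift.congr_fun fun k => ?_
  simp only [Function.comp, Equiv.coe_addRight, Int.cast_add]
  ring_nf

/-! ### The simple poles contribute nothing: a telescoping lemma -/

/-- Unit telescoping on the line: `Σ_{k∈ℤ} (1/(z+k+1) − 1/(z+k)) = 0` (`z` off the integers). -/
theorem hasSum_telescope_one (z : ℂ) (hz : ∀ k : ℤ, z + k ≠ 0) :
    HasSum (fun k : ℤ => 1 / (z + k + 1) - 1 / (z + k)) 0 := by
  set T : ℤ → ℂ := fun k => 1 / (z + k + 1) - 1 / (z + k) with hT
  -- summability: `T k = -1/((z+k+1)(z+k))`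
  have hS : Summable T := by
    have h := EisensteinSeries.summable_linear_right_add_one_mul_linear_right z 1 1
    refine (h.neg).congr fun k => ?_
    have h1 : z + k + 1 ≠ 0 := by have := hz (k + 1); push_cast at this; rwa [← add_assoc] at this
    have h0 : z + k ≠ 0 := hz k
    rw [hT]
    simp only [Int.cast_one, one_mul]
    field_simp
    ring
  -- the folded series over `ℕ` telescopes symmetrically
  set F : ℤ → ℂ := fun k => 1 / (z + k) with hF
  have hfold : HasSum (fun n : ℕ => T n + T (-(n + 1))) 0 := by
    have hS' : Summable fun n : ℕ => T n + T (-(n + 1)) := hS.nat_add_neg_add_one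
    rw [hS'.hasSum_iff_tendsto_nat]
    have hpartial : ∀ N : ℕ, ∑ i ∈ range N, (T i + T (-(i + 1))) = F N - F (-(N : ℤ)) := by
      intro N
      induction N with
      | zero => simp [hF]
      | succ N ih =>
        rw [sum_range_succ, ih]
        simp only [hT, hF]
        push_cast
        ring
    simp_rw [hpartial]
    have hplus : Tendsto (fun N : ℕ => F N) atTop (𝓝 0) := by
      have := EisensteinSeries.tendsto_zero_inv_linear z 1
      simp only [Int.cast_one, one_mul] at this
      refine this.congr fun N => ?_
      simp [hF]
    have hminus : Tendsto (fun N : ℕ => F (-(N : ℤ))) atTop (𝓝 0) := by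
      have := EisensteinSeries.tendsto_zero_inv_linear_sub z 1
      simp only [Int.cast_one, one_mul] at this
      refine this.congr fun N => ?_
      simp [hF, sub_eq_add_neg]
    simpa using hplus.sub hminus
  -- the ℤ-sum equals the folded ℕ-sum
  have key : ∑' k : ℤ, T k = 0 := by
    rw [← tsum_nat_add_neg_add_one hS, hfold.tsum_eq]
  rw [← key]
  exact hS.hasSum

/-- Telescoping by `m` steps: `Σ_{k∈ℤ} (1/(z+k+m) − 1/(z+k)) = 0`. -/
theorem hasSum_telescope (z : ℂ) (hz : ∀ k : ℤ, z + k ≠ 0) (m : ℕ) :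
    HasSum (fun k : ℤ => 1 / (z + k + m) - 1 / (z + k)) 0 := by
  induction m generalizing z with
  | zero =>
    have : (fun k : ℤ => 1 / (z + k + ((0 : ℕ) : ℂ)) - 1 / (z + k)) = fun _ => 0 := by
      funext k; simp
    rw [this]; exact hasSum_zero
  | succ m ih =>
    have hz1 : ∀ k : ℤ, (z + 1) + k ≠ 0 := fun k => by
      have := hz (k + 1); push_cast at this; intro h0; exact this (by linear_combination h0)
    have h := (ih (z + 1) hz1).add (hasSum_telescope_one z hz)
    rw [add_zero] at h
    refine h.congr_fun fun k => ?_
    push_cast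
    ring

/-- A point of the line `ℤ + iY` (`Y ≠ 0`) is not a pole: `k + iY + p + 1 ≠ 0`. -/
theorem line_ne_pole {Y : ℝ} (hY0 : Y ≠ 0) (k : ℤ) (p : ℕ) : (k : ℂ) + Y * I + p + 1 ≠ 0 := by
  intro h0
  have := congrArg Complex.im h0
  simp at this
  exact hY0 this

/-- `iY + k ≠ 0` for `Y ≠ 0`. -/
theorem lineBase_ne {Y : ℝ} (hY0 : Y ≠ 0) (k : ℤ) : (Y : ℂ) * I + k ≠ 0 := by
  intro h0
  have := congrArg Complex.im h0
  simp at this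
  exact hY0 this

/-! ### The lattice-sum identity -/

section Line

variable {b : ℕ → ℤ} (hb : InBox b) (hsum : ∑ j ∈ range 7, b (j + 1) ≤ 3 * b 0 + 1)
include hb hsum

/-- The simple poles of `R_b` contribute nothing on the line: `Σ_{k∈ℤ} Σ_p c_{0,p}/(k+iY+p+1) = 0`
(because `Σ_p c_{0,p} = 0`, `CressonFischlerRivoal2008.sum_pf_data_zero`, and telescoping). -/
theorem hasSum_order_zero_line {Y : ℝ} (hY0 : 0 < Y) :
    HasSum (fun k : ℤ => ∑ p ∈ range ((b 0).toNat + 1),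
      ((pfData b 0 p : ℚ) : ℂ) / ((k : ℂ) + Y * I + p + 1)) 0 := by
  set n := (b 0).toNat with hn
  obtain ⟨c₀, hc₀⟩ := exists_isPFData b hb hsum
  have hc : IsPFData b (pfData b) := isPFData_pfData hc₀
  -- `Σ_p c_{0,p} = 0`
  have hdeg : ((numPoly b).comp (Polynomial.X + Polynomial.C 1)).natDegree + 2 ≤ 6 * (n + 1) := by
    rw [Polynomial.natDegree_comp, Polynomial.natDegree_X_add_C, mul_one]
    exact natDegree_numPoly_add_two_le b hb hsum
  have hC0 : ∑ p ∈ range (n + 1), pfData b 0 p = 0 :=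
    Literature.NumberTheory.Irrationality.CressonFischlerRivoal2008.sum_pf_data_zero n 6 (by norm_num)
      _ hdeg (pfData b) hc
  have hC0' : ∑ p ∈ range (n + 1), ((pfData b 0 p : ℚ) : ℂ) = 0 := by exact_mod_cast hC0
  -- rewrite each term with the telescoping correction
  have hz := lineBase_ne hY0.ne'
  have hterm : ∀ k : ℤ, ∑ p ∈ range (n + 1), ((pfData b 0 p : ℚ) : ℂ) / ((k : ℂ) + Y * I + p + 1) =
      ∑ p ∈ range (n + 1), ((pfData b 0 p : ℚ) : ℂ) *
        (1 / ((Y : ℂ) * I + k + ((p + 1 : ℕ) : ℂ)) - 1 / ((Y : ℂ) * I + k)) := by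
    intro k
    have hsplit : ∑ p ∈ range (n + 1), ((pfData b 0 p : ℚ) : ℂ) *
        (1 / ((Y : ℂ) * I + k + ((p + 1 : ℕ) : ℂ)) - 1 / ((Y : ℂ) * I + k)) =
        ∑ p ∈ range (n + 1), ((pfData b 0 p : ℚ) : ℂ) * (1 / ((Y : ℂ) * I + k + ((p + 1 : ℕ) : ℂ)))
          - (∑ p ∈ range (n + 1), ((pfData b 0 p : ℚ) : ℂ)) * (1 / ((Y : ℂ) * I + k)) := by
      rw [sum_mul, ← sum_sub_distrib]
      refine sum_congr rfl fun p _ => by ring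
    rw [hsplit, hC0', zero_mul, sub_zero]
    refine sum_congr rfl fun p _ => ?_
    push_cast
    ring_nf
  simp_rw [hterm]
  have h := hasSum_sum (s := range (n + 1))
    (f := fun p (k : ℤ) => ((pfData b 0 p : ℚ) : ℂ) *
      (1 / ((Y : ℂ) * I + k + ((p + 1 : ℕ) : ℂ)) - 1 / ((Y : ℂ) * I + k)))
    (a := fun p => ((pfData b 0 p : ℚ) : ℂ) * 0)
    (fun p _ => (hasSum_telescope ((Y : ℂ) * I) hz (p + 1)).mul_left _)
  simpa using h

/-- **THE LATTICE-SUM IDENTITY.** For `b` in the box and `Y > 0`: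
`Σ_{k∈ℤ} R_b(k + iY) = i·(4π³·A₂(Y)·W(b) − (4/3)π⁵·A₄(Y)·U(b))`. -/
theorem hasSum_Rc_line {Y : ℝ} (hY0 : 0 < Y) :
    HasSum (fun k : ℤ => Rc b ((k : ℂ) + Y * I))
      (I * (4 * π ^ 3 * Aq 2 Y * ((coeffW b : ℚ) : ℂ) - 4 * π ^ 5 / 3 * Aq 4 Y * ((coeffU b : ℚ) : ℂ))) := by
  set n := (b 0).toNat with hn
  obtain ⟨c₀, hc₀⟩ := exists_isPFData b hb hsum
  have hc : IsPFData b (pfData b) := isPFData_pfData hc₀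
  -- expand `R_b` on the line and split off the simple poles
  have hexp : ∀ k : ℤ, Rc b ((k : ℂ) + Y * I) =
      (∑ p ∈ range (n + 1), ∑ o ∈ range 5, ((pfData b (o + 1) p : ℚ) : ℂ) *
        (1 / ((k : ℂ) + ((p + 1 : ℕ) : ℤ) + Y * I) ^ (o + 1 + 1))) +
      ∑ p ∈ range (n + 1), ((pfData b 0 p : ℚ) : ℂ) / ((k : ℂ) + Y * I + p + 1) := by
    intro k
    rw [Rc_eq_pf b hb hsum _ (fun p _ => line_ne_pole hY0.ne' k p), ← hn, ← sum_add_distrib]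
    refine sum_congr rfl fun p _ => ?_
    rw [sum_range_succ']
    congr 1
    · refine sum_congr rfl fun o _ => ?_
      push_cast
      ring_nf
    · ring
  simp_rw [hexp]
  -- the higher orders: Eisenstein on each term
  have hmain := hasSum_sum (s := range (n + 1))
    (f := fun p (k : ℤ) => ∑ o ∈ range 5, ((pfData b (o + 1) p : ℚ) : ℂ) *
        (1 / ((k : ℂ) + ((p + 1 : ℕ) : ℤ) + Y * I) ^ (o + 1 + 1)))
    (a := fun p => ∑ o ∈ range 5, ((pfData b (o + 1) p : ℚ) : ℂ) *
        ((-2 * π * I) ^ (o + 1 + 1) / ((o + 1).factorial : ℂ) * Aq (o + 1) Y))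
    (fun p _ => hasSum_sum (fun o _ => (hasSum_inv_pow_line hY0 (by omega) _).mul_left _))
  have hall := hmain.add (hasSum_order_zero_line hb hsum hY0)
  rw [add_zero] at hall
  convert hall using 1
  -- the value: swap the sums, use `Σ_p c_{o,p} = 0` for odd `o`, `= W` for `o = 2`, `= U` for `o = 4`
  set Cs : ℕ → ℂ := fun o => ∑ p ∈ range (n + 1), ((pfData b o p : ℚ) : ℂ) with hCs
  set E : ℕ → ℂ := fun j => (-2 * π * I) ^ (j + 1) / (j.factorial : ℂ) * Aq j Y with hE
  rw [sum_comm]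
  have hfac : ∀ o ∈ range 5, ∑ p ∈ range (n + 1), ((pfData b (o + 1) p : ℚ) : ℂ) *
      ((-2 * π * I) ^ (o + 1 + 1) / ((o + 1).factorial : ℂ) * Aq (o + 1) Y) = Cs (o + 1) * E (o + 1) := by
    intro o _
    rw [hCs, hE, sum_mul]
  rw [sum_congr rfl hfac]
  have hodd : ∀ o, o < 6 → Odd o → Cs o = 0 := by
    intro o ho hodd
    have := sum_pfData_odd b hb hc ho hodd
    rw [← hn] at this
    show ∑ p ∈ range (n + 1), ((pfData b o p : ℚ) : ℂ) = 0
    exact_mod_cast this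
  have hW : Cs 2 = ((coeffW b : ℚ) : ℂ) := by
    rw [hCs, coeffW_eq hc, ← hn]; push_cast; rfl
  have hU : Cs 4 = ((coeffU b : ℚ) : ℂ) := by
    rw [hCs, coeffU_eq hc, ← hn]; push_cast; rfl
  have hI3 : I ^ 3 = -I := by rw [pow_succ, I_sq]; ring
  have hI5 : I ^ 5 = I := by rw [show (5 : ℕ) = 4 + 1 by rfl, pow_succ, I_pow_four]; ring
  have hp3 : (-2 * (π : ℂ) * I) ^ 3 = 8 * π ^ 3 * I := by linear_combination (-8 * (π : ℂ) ^ 3) * hI3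
  have hp5 : (-2 * (π : ℂ) * I) ^ 5 = -32 * π ^ 5 * I := by linear_combination (-32 * (π : ℂ) ^ 5) * hI5
  have hE2 : E 2 = 4 * π ^ 3 * I * Aq 2 Y := by
    rw [hE]
    simp only [Nat.factorial, Nat.succ_eq_add_one, Nat.reduceAdd, Nat.reduceMul, Nat.cast_ofNat, hp3]
    ring
  have hE4 : E 4 = -(4 * π ^ 5 / 3) * I * Aq 4 Y := by
    rw [hE]
    simp only [Nat.factorial, Nat.succ_eq_add_one, Nat.reduceAdd, Nat.reduceMul, Nat.cast_ofNat, hp5]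
    ring
  simp only [sum_range_succ, sum_range_zero, zero_add, Nat.reduceAdd]
  rw [hodd 1 (by norm_num) (by decide), hodd 3 (by norm_num) (by decide), hodd 5 (by norm_num) (by decide),
    hW, hU, hE2, hE4]
  ring

end Line

end Summit.KontsevichZagierPeriods.Zeta5Search.DualPF
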